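import Literature.Probability.RandomPlanarGeometry.StarBubbleMassSign
import Literature.Probability.RandomPlanarGeometry.BrownianExcursionRestriction
import HarnessLib

/-!
# The harmonic function behind the Brownian bubble hitting masses: `ψ_A = |z|⁻² − Im(−Φ_A'(0)/Φ_A(z))/Im z` on `ℝ⁴`

Proof file (definitions with bodies, no named fact), after

* G. F. Lawler, O. Schramm, W. Werner, *Conformal restriction: the chordal case*, J. Amer. Math.
  Soc. **16** (2003) 917–955, arXiv:math/0209343 (**[LSW]**), §7.1 eq. (7.2)
  ("`μ[K ∩ A ≠ ∅] = −S g_A(0)/6`" for the Brownian bubble measure `μ` at `0` and `A ∈ 𝒬*`) with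
  §5 eq. (5.1), and §4 p. 16 (the excursion realised by a three-dimensional Bessel process =
  modulus of a three-dimensional Brownian motion);
* G. F. Lawler, *Conformally Invariant Processes in the Plane*, AMS (2005), Prop. 5.22
  ("`μ^bub_ℍ(0){γ : γ(0,t_γ) ⊄ D} = hcap(A) = −Sf(0)/6`").

This is the ANALYTIC half of the identity `E_0[|W_{τ_A}|⁻²; τ_A < ∞] = −SΦ_A(0)/6` for a
four-dimensional Brownian motion `W` and the lifted hull `exPt⁻¹ A` (the hitting mass of the
Brownian loop measure at `0` in `ℝ⁴`, `Process/BrownianLoopDensity4`, whose image under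
`W ↦ W⁰ + i|w|` is the Brownian bubble measure): the function

  `ψ_A(p) = N(p) − u_A(p)`,  `N(p) = 1/|z|²`,  `u_A(p) = Im(−d/Φ_A(z))/Im z`,  `z = x + i|w|`, `d = Φ_A'(0)`,

written as a difference of two excursion ratios of conformal maps into `ℍ` (`z ↦ −1/z` and
`Ψ = −d/Φ_A`, `negInvEmpty`, `negDivMap`), so that the tree's `lap_excursionRatio_eq_zero`
(`ExcursionRestrictionHarmonic`) makes it harmonic on `D_A` for free. Contents, all PROVED:

* `lap_bubbleHarmonic_eq_zero`, `contDiffOn_bubbleHarmonic` — `ψ_A ∈ C²(D_A)`, `Δψ_A = 0`;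
* bounds: `0 ≤ N ≤ 1/r²` off `B(0, r)`, `0 < u_A ≤ d/|Φ_A(z)|²` (`Im Φ_A ≤ Im`);
* `norm_apply_ge_of_le_norm`, `exists_forall_norm_apply_ge` — **`|Φ_A(z)| ≥ dρ/4` for
  `|z| ≥ ρ`** on all of `ℍ ∖ A` (Koebe one-quarter for the univalent reflection `E_A` on
  `B(0, 4ρ₀)`, `Loewner.injOn_hullExt_ball`, and injectivity of `Φ_A` on `ℍ ∖ A`), and
  `exists_forall_norm_apply_ge_half` — `|Φ_A(z)| ≥ |z|/2` far out (`E_A(z) − z → L_A`);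
* the germ at `0`: `bubbleGerm Φ = (dslope q 0)/q`, `q = dslope E_A 0` — the holomorphic function
  `F(z) = −d/E_A(z) + 1/z` at `0`, real on `ℝ`, with (`hasStrictDerivAt_bubbleGerm`, power-series
  bookkeeping `bubbleGerm_data`) `F'(0) = germSlope = E‴(0)/(6d) − (E″(0)/2)²/d² = SΦ_A(0)/6`;
  `tendsto_im_bubbleGerm_div_im`: `Im F(z)/Im z → F'(0)` inside `ℍ ∖ A` (strict differentiability
  and `Im F(z)/Im z = (F(z) − F(z̄))/(z − z̄)`, as in `IsRestrictionMap.tendsto_im_div_im_nhdsWithin_zero`);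
  `bubbleHarmonic_eq_neg_im_bubbleGerm`: `ψ_A = −Im F/Im z` near `0`; hence
  **`tendsto_bubbleHarmonic_starRMap`: `ψ_A(p) → −SΦ_A(0)/6 = starBubbleMass A` as `p → 0` in `D_A`**;
* boundary values: `tendsto_bubbleHarmonic_of_mem` — `ψ_A(p) → 1/|z_q|²` at points `q` over
  `A ∩ ℍ`; `exists_forall_abs_bubbleHarmonic_le_div` — `|ψ_A| ≤ (1 + 4d)/|z|²` far out;
  `exists_forall_abs_bubbleHarmonic_le` — `ψ_A` is bounded on `D_A` (canonical data).

So `ψ_A` is the bounded harmonic function on `ℝ⁴ ∖ (exPt⁻¹ A ∪ axis)` with boundary values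
`|·|⁻²` on the lifted hull, `0` at `∞`, and value `−SΦ_A(0)/6` at the origin; the optional
stopping argument turning this into `E_0[|W_{τ_A}|⁻²; τ_A < ∞] = −SΦ_A(0)/6` is the sibling
`BubbleHittingMass`. Sanity check (by hand, not shipped): for `A` the half-disc `|z − 2| ≤ 1`,
`Φ_A = z + 1/(z−2) + 1/2`, `−SΦ_A(0)/6 = 1/9 = hcap` of the inverted half-disc of radius `1/3`,
and `E_0[|W_τ|⁻²]` for the lifted 4-ball `|v − 2e₀| ≤ 1` is `1/9` by the Kelvin transform.

## References

* [LSW] §7.1 (7.2), §5 (5.1), §4 p. 16. [LawlerSchrammWerner2003Restriction]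
* G. F. Lawler, *Conformally Invariant Processes in the Plane* (2005), Thm. 3.17 (Koebe 1/4),
  Prop. 5.22. [Lawler2005]
-/
noncomputable section

open Set Filter Metric Function Complex Bornology
open _root_.Topology
open UpperHalfPlane (upperHalfPlaneSet)
open Literature.Probability.Process (lap hess bvec)
open scoped NNReal ComplexConjugate

namespace Literature.Probability.RandomPlanarGeometry

open Loewner

variable {A : Set ℂ}

/-! ### The maps `−d/Φ_A` and `−1/z`, and the functions `u_A`, `N`, `ψ_A` on `ℝ⁴` -/

/-- **The conformal map `Ψ = −d/Φ : ℍ ∖ A → ℍ`** (`Φ` followed by the inversion `w ↦ −1/w` and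
the dilation by `d > 0`, both automorphisms of `ℍ`). [folklore] -/
def negDivMap (Φ : ConformalEquiv (upperHalfPlaneSet \ A) upperHalfPlaneSet) (d : ℝ) (hd : 0 < d) :
    ConformalEquiv (upperHalfPlaneSet \ A) upperHalfPlaneSet :=
  Φ.trans (invEquivUpperHalfPlane.trans (ConformalEquiv.smulUpperHalfPlane d hd))

/-- `Ψ z = −d/Φ z`. [folklore] -/
theorem negDivMap_apply (Φ : ConformalEquiv (upperHalfPlaneSet \ A) upperHalfPlaneSet) {d : ℝ}
    (hd : 0 < d) (z : ℂ) : negDivMap Φ d hd z = -(d : ℂ) / Φ z := by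
  simp only [negDivMap, ConformalEquiv.trans_apply, invEquivUpperHalfPlane_apply,
    ConformalEquiv.smulUpperHalfPlane_apply, Complex.real_smul]
  ring

/-- **The conformal map `z ↦ −1/z` of `ℍ = ℍ ∖ ∅` onto `ℍ`.** [folklore] -/
def negInvEmpty : ConformalEquiv (upperHalfPlaneSet \ ∅) upperHalfPlaneSet :=
  restrictionMapEmpty.trans invEquivUpperHalfPlane

/-- `negInvEmpty z = −1/z`. [folklore] -/
@[simp] theorem negInvEmpty_apply (z : ℂ) : negInvEmpty z = -z⁻¹ := by
  simp [negInvEmpty, ConformalEquiv.trans_apply, invEquivUpperHalfPlane_apply, restrictionMapEmpty_apply]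

/-- `Im(−1/z) = Im z/|z|²`. [folklore] -/
theorem neg_inv_im (z : ℂ) : (-z⁻¹).im = z.im / Complex.normSq z := by
  simp [Complex.inv_im, neg_div]

/-- `Im(−d/w) = d · Im w/|w|²`. [folklore] -/
theorem neg_div_im (d : ℝ) (w : ℂ) : (-(d : ℂ) / w).im = d * w.im / Complex.normSq w := by
  rw [div_eq_mul_inv, neg_mul, ← mul_neg, Complex.mul_im, Complex.ofReal_re, Complex.ofReal_im,
    zero_mul, add_zero, neg_inv_im]
  ring

/-- **`N(p) = 1/|z|²` at `z = x + i|w|`, as the excursion ratio of `−1/z`**: for `p` off the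
axis, `Im(−1/z)/Im z = 1/|z|²`. [folklore] -/
theorem excursionRatio_negInvEmpty {p : Fin 4 → ℝ} (hp : exRad p ≠ 0) :
    excursionRatio negInvEmpty p = (Complex.normSq (exPt p))⁻¹ := by
  rw [excursionRatio, negInvEmpty_apply, neg_inv_im, exPt_im]
  field_simp

/-- **`u_A(p) = Im(−d/Φ_A(z))/Im z = d · (Im Φ_A(z)/Im z)/|Φ_A(z)|²`** at `z = x + i|w|`: the
excursion ratio of `Ψ = −d/Φ` is `d/|Φ|²` times that of `Φ`. [folklore] -/
theorem excursionRatio_negDivMap (Φ : ConformalEquiv (upperHalfPlaneSet \ A) upperHalfPlaneSet)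
    {d : ℝ} (hd : 0 < d) (p : Fin 4 → ℝ) :
    excursionRatio (negDivMap Φ d hd) p = d * excursionRatio Φ p / Complex.normSq (Φ (exPt p)) := by
  rw [excursionRatio, excursionRatio, negDivMap_apply, neg_div_im]
  ring

/-- **The harmonic function `ψ_A = N − u_A` on `ℝ⁴`** (meaningful on `D_A`): at `z = x + i|w|`,
`ψ_A(p) = 1/|z|² − Im(−d/Φ_A(z))/Im z` with `d = Φ_A'(0)`. It is the function whose value at
`0` is `−SΦ_A(0)/6` and whose boundary values on the lifted hull are `1/|z|²`: the harmonic
representative of `E_p[|W_{τ_A}|⁻²; τ_A < ∞]`. [folklore] -/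
def bubbleHarmonic (Φ : ConformalEquiv (upperHalfPlaneSet \ A) upperHalfPlaneSet) (d : ℝ) (hd : 0 < d)
    (p : Fin 4 → ℝ) : ℝ :=
  excursionRatio negInvEmpty p - excursionRatio (negDivMap Φ d hd) p

/-! ### Regularity and harmonicity on `D_A` -/

/-- `D_A ⊆ D_∅` (off the axis). [folklore] -/
theorem exDom_subset_exDom_empty (A : Set ℂ) : exDom A ⊆ exDom ∅ := fun _ hp ↦ ⟨hp.1, fun h ↦ h⟩

/-- The Laplacian of a difference of `C²` functions. [folklore] -/
theorem _root_.Literature.Probability.Process.lap_sub {d : ℕ} {f g : (Fin d → ℝ) → ℝ} {x : Fin d → ℝ}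
    (hf : ContDiffAt ℝ 2 f x) (hg : ContDiffAt ℝ 2 g x) : lap (f - g) x = lap f x - lap g x := by
  have hf1 : ∀ᶠ y in 𝓝 x, DifferentiableAt ℝ f y :=
    (hf.eventually (by norm_num)).mono fun y hy ↦ hy.differentiableAt (by norm_num)
  have hg1 : ∀ᶠ y in 𝓝 x, DifferentiableAt ℝ g y :=
    (hg.eventually (by norm_num)).mono fun y hy ↦ hy.differentiableAt (by norm_num)
  have hsub : fderiv ℝ (f - g) =ᶠ[𝓝 x] fun y ↦ fderiv ℝ f y - fderiv ℝ g y := by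
    filter_upwards [hf1, hg1] with y hfy hgy
    exact fderiv_sub hfy hgy
  have hff : DifferentiableAt ℝ (fderiv ℝ f) x :=
    (hf.fderiv_right (m := 1) (by norm_num)).differentiableAt (by norm_num)
  have hgg : DifferentiableAt ℝ (fderiv ℝ g) x :=
    (hg.fderiv_right (m := 1) (by norm_num)).differentiableAt (by norm_num)
  have hhess : hess (f - g) x = hess f x - hess g x := by
    unfold hess
    rw [hsub.fderiv_eq, fderiv_fun_sub hff hgg]
  simp only [lap, hhess, sub_apply, Finset.sum_sub_distrib]

section Basic

variable {Φ : ConformalEquiv (upperHalfPlaneSet \ A) upperHalfPlaneSet} {d : ℝ} {hd : 0 < d}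

/-- **`ψ_A` is `C²` on `D_A`.** [folklore] -/
theorem contDiffOn_bubbleHarmonic (hA : IsClosed A) :
    ContDiffOn ℝ 2 (bubbleHarmonic Φ d hd) (exDom A) :=
  ((contDiffOn_excursionRatio_two isClosed_empty).mono (exDom_subset_exDom_empty A)).sub
    (contDiffOn_excursionRatio_two hA)

/-- **`Δψ_A = 0` on `D_A`** (both `N` and `u_A` are excursion ratios of conformal maps into `ℍ`,
`lap_excursionRatio_eq_zero`). [folklore] -/
theorem lap_bubbleHarmonic_eq_zero (hA : IsClosed A) {p : Fin 4 → ℝ} (hp : p ∈ exDom A) :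
    lap (bubbleHarmonic Φ d hd) p = 0 := by
  have hO : IsOpen (exDom A) := isOpen_exDom hA
  have hO' : IsOpen (exDom (∅ : Set ℂ)) := isOpen_exDom isClosed_empty
  have hp' : p ∈ exDom (∅ : Set ℂ) := exDom_subset_exDom_empty A hp
  have h1 : ContDiffAt ℝ 2 (excursionRatio negInvEmpty) p :=
    (contDiffOn_excursionRatio_two isClosed_empty).contDiffAt (hO'.mem_nhds hp')
  have h2 : ContDiffAt ℝ 2 (excursionRatio (negDivMap Φ d hd)) p :=
    (contDiffOn_excursionRatio_two hA).contDiffAt (hO.mem_nhds hp)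
  have heq : bubbleHarmonic Φ d hd = excursionRatio negInvEmpty - excursionRatio (negDivMap Φ d hd) := rfl
  rw [heq, Literature.Probability.Process.lap_sub h1 h2, lap_excursionRatio_eq_zero isClosed_empty hp',
    lap_excursionRatio_eq_zero hA hp, sub_zero]

/-! ### Bounds: `0 ≤ N ≤ 1/|z|²`, `0 < u_A ≤ d/|Φ_A(z)|²` -/

/-- `‖exPt p‖² = normSq`. [folklore] -/
theorem normSq_exPt_eq (p : Fin 4 → ℝ) : Complex.normSq (exPt p) = ‖exPt p‖ ^ 2 :=
  (Complex.sq_norm _).symm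

/-- `0 ≤ N`. [folklore] -/
theorem excursionRatio_negInvEmpty_nonneg {p : Fin 4 → ℝ} (hp : exRad p ≠ 0) :
    0 ≤ excursionRatio negInvEmpty p := by
  rw [excursionRatio_negInvEmpty hp]
  exact inv_nonneg.2 (Complex.normSq_nonneg _)

/-- `N(p) ≤ 1/r²` when `‖z‖ ≥ r > 0`. [folklore] -/
theorem excursionRatio_negInvEmpty_le {p : Fin 4 → ℝ} (hp : exRad p ≠ 0) {r : ℝ} (hr : 0 < r)
    (hrp : r ≤ ‖exPt p‖) : excursionRatio negInvEmpty p ≤ 1 / r ^ 2 := by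
  rw [excursionRatio_negInvEmpty hp, normSq_exPt_eq, one_div]
  exact inv_anti₀ (by positivity) (pow_le_pow_left₀ hr.le hrp 2)

/-- **`u_A ≤ d/|Φ_A(z)|²` on `D_A`** (`Im Φ_A(z) ≤ Im z`). [cite: LawlerSchrammWerner2003Restriction, §2 p. 7 (Im g_A(z) ≤ Im z)] -/
theorem excursionRatio_negDivMap_le (hA : IsStarHull A) (hΦ : IsRestrictionMap A Φ) {p : Fin 4 → ℝ}
    (hp : p ∈ exDom A) : excursionRatio (negDivMap Φ d hd) p ≤ d / Complex.normSq (Φ (exPt p)) := by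
  rw [excursionRatio_negDivMap]
  have h1 : excursionRatio Φ p ≤ 1 := excursionRatio_le_one hA.1.1 hΦ hp
  have h0 : 0 ≤ Complex.normSq (Φ (exPt p)) := Complex.normSq_nonneg _
  rcases h0.eq_or_lt with h | h
  · rw [← h]; simp
  · rw [div_le_div_iff_of_pos_right h]
    nlinarith [hd]

/-- `0 < u_A` on `D_A`. [folklore] -/
theorem excursionRatio_negDivMap_pos {p : Fin 4 → ℝ} (hp : p ∈ exDom A) :
    0 < excursionRatio (negDivMap Φ d hd) p :=
  excursionRatio_pos hp

/-- **`ψ_A ≤ N ≤ 1/r²`** on `D_A ∩ {‖z‖ ≥ r}`. [folklore] -/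
theorem bubbleHarmonic_le {p : Fin 4 → ℝ} (hp : p ∈ exDom A) {r : ℝ} (hr : 0 < r) (hrp : r ≤ ‖exPt p‖) :
    bubbleHarmonic Φ d hd p ≤ 1 / r ^ 2 := by
  have h1 := excursionRatio_negInvEmpty_le hp.1 hr hrp
  have h2 := excursionRatio_negDivMap_pos (Φ := Φ) (hd := hd) hp
  unfold bubbleHarmonic
  linarith

/-- **`−d/c² ≤ ψ_A`** where `|Φ_A(z)| ≥ c > 0`. [folklore] -/
theorem neg_le_bubbleHarmonic (hA : IsStarHull A) (hΦ : IsRestrictionMap A Φ) {p : Fin 4 → ℝ}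
    (hp : p ∈ exDom A) {c : ℝ} (hc : 0 < c) (hcp : c ≤ ‖Φ (exPt p)‖) :
    -(d / c ^ 2) ≤ bubbleHarmonic Φ d hd p := by
  have h1 := excursionRatio_negInvEmpty_nonneg hp.1
  have h2 := excursionRatio_negDivMap_le (hd := hd) hA hΦ hp
  have h3 : d / Complex.normSq (Φ (exPt p)) ≤ d / c ^ 2 := by
    rw [Complex.normSq_eq_norm_sq]
    exact div_le_div_of_nonneg_left hd.le (by positivity) (pow_le_pow_left₀ hc.le hcp 2)
  unfold bubbleHarmonic
  linarith


end Basic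

/-! ### `|Φ_A(z)|` is bounded below away from `0`, and `≍ |z|` at `∞` -/

section LowerBound

variable {B : Set ℂ} {Φ : ConformalEquiv (upperHalfPlaneSet \ B) upperHalfPlaneSet} {d ρ₀ : ℝ}
variable (hB : IsStarHull B) (hΦ : IsRestrictionMap B Φ) (hd : HasRestrictionDeriv B Φ d)
  (hρ₀ : 0 < ρ₀) (hBρ : Disjoint (ball (0 : ℂ) (8 * ρ₀)) B)
include hB hΦ hd hρ₀ hBρ

/-- **Koebe lower bound for `Φ_B` on all of `ℍ ∖ B`**: `|Φ_B(z)| ≥ dρ/4` whenever `z ∈ ℍ ∖ B`,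
`|z| ≥ ρ`, `0 < ρ ≤ 4ρ₀` (`B(0, 8ρ₀) ∩ B = ∅`). By Koebe's one-quarter theorem
`B(0, dρ/4) ⊆ E_B(B(0, ρ))`; a point of `E_B(B(0,ρ)) ∩ ℍ` is `E_B(y) = Φ_B(y)` with `y` in the
UPPER half of the small ball (the reflection sends the lower half below the axis and real points
to real points), and `Φ_B` is injective on `ℍ ∖ B`. [cite: Lawler2005, Thm. 3.17 (Koebe 1/4)] -/
theorem norm_apply_ge_of_le_norm {ρ : ℝ} (hρ : 0 < ρ) (hρ4 : ρ ≤ 4 * ρ₀) {z : ℂ}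
    (hz : z ∈ upperHalfPlaneSet \ B) (hρz : ρ ≤ ‖z‖) : d * ρ / 4 ≤ ‖Φ z‖ := by
  have hinj := injOn_hullExt_ball hB hΦ hd hρ₀ hBρ
  have hsub : ball (0 : ℂ) ρ ⊆ ball (0 : ℂ) (4 * ρ₀) := ball_subset_ball hρ4
  have hsymm : ball (0 : ℂ) (4 * ρ₀) ⊆ symmDomain B := by
    have := ball_subset_symmDomain (B := B) (x := 0) (r := 8 * ρ₀) (by simpa using hBρ)
    rw [ofReal_zero] at this
    exact (ball_subset_ball (by linarith)).trans this
  have hdiff : DifferentiableOn ℂ (hullExt Φ) (ball (0 : ℂ) ρ) :=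
    (differentiableOn_hullExt hB.isBoundedHull hΦ).mono (hsub.trans hsymm)
  obtain ⟨hFd, hFinj, hFder⟩ :=
    Literature.Analysis.Complex.AreaThm.rescale_ball (c := 0) hρ hdiff (hinj.mono hsub)
  simp only [zero_add] at hFd hFinj hFder
  have hF0 : hullExt Φ ((ρ : ℂ) * 0) = 0 := by simp [hullExt_zero hB hΦ]
  have hFder0 : deriv (fun ζ : ℂ ↦ hullExt Φ (ρ * ζ)) 0 = ρ * d := by
    rw [hFder 0 (mem_ball_self one_pos), mul_zero, deriv_hullExt_zero hB hΦ hd]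
  have hK := Literature.Analysis.Complex.koebeQuarter_holds _ hFd hFinj
  simp only [hF0, hFder0] at hK
  have hd0 := (restrictionDeriv_pos_le_one hB hΦ hd).1
  by_contra hlt
  push Not at hlt
  have hmem : Φ z ∈ ball (0 : ℂ) (‖(ρ : ℂ) * d‖ / 4) := by
    rw [mem_ball_zero_iff, norm_mul, norm_real, norm_real, Real.norm_of_nonneg hρ.le,
      Real.norm_of_nonneg hd0.le]
    linarith
  obtain ⟨ζ, hζ, hζeq⟩ := hK hmem
  -- the preimage point `y = ρ ζ` of the small ball
  set y : ℂ := (ρ : ℂ) * ζ with hy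
  have hyρ : y ∈ ball (0 : ℂ) ρ := by
    rw [mem_ball_zero_iff] at hζ ⊢
    rw [hy, norm_mul, norm_real, Real.norm_of_nonneg hρ.le]
    nlinarith
  have hysymm : y ∈ symmDomain B := hsymm (hsub hyρ)
  have hEy : hullExt Φ y = Φ z := hζeq
  have hΦz : 0 < (Φ z).im := Φ.mapsTo hz
  -- `y` lies in the open upper half-plane
  have hyim : 0 < y.im := by
    rcases lt_trichotomy y.im 0 with him | him | him
    · have := hullExt_im_neg hB.isBoundedHull hΦ hysymm him
      rw [hEy] at this
      linarith
    · have hyre : y = ((y.re : ℝ) : ℂ) := Complex.ext (by simp) (by simp [him])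
      have hnot : ((y.re : ℝ) : ℂ) ∉ B := by rw [← hyre]; exact hysymm.1
      have := hullExt_ofReal_im hB.isBoundedHull hΦ hnot
      rw [← hyre, hEy] at this
      linarith
    · exact him
  have hyO : y ∈ upperHalfPlaneSet \ B := ⟨hyim, hysymm.1⟩
  have hΦy : Φ y = Φ z := by rw [← hullExt_of_mem_diff hyO, hEy]
  have heq : y = z := Φ.injOn hyO hz hΦy
  have : ‖z‖ < ρ := by rw [← heq]; exact mem_ball_zero_iff.1 hyρ
  linarith

end LowerBound

section GlobalBounds

variable {Φ : ConformalEquiv (upperHalfPlaneSet \ A) upperHalfPlaneSet}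

/-- **`|Φ_A|` is bounded below away from `0`**: for `A ∈ 𝒬*`, a restriction map `Φ` and
`r > 0` there is `c > 0` with `|Φ(z)| ≥ c` for all `z ∈ ℍ ∖ A` with `|z| ≥ r`. [folklore] -/
theorem exists_forall_norm_apply_ge (hA : IsStarHull A) (hΦ : IsRestrictionMap A Φ) {r : ℝ}
    (hr : 0 < r) : ∃ c : ℝ, 0 < c ∧ ∀ z ∈ upperHalfPlaneSet \ A, r ≤ ‖z‖ → c ≤ ‖Φ z‖ := by
  obtain ⟨r', hr'0, hr'⟩ := hA.exists_disjoint_ball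
  obtain ⟨d', hd'0, -, hd'⟩ := IsStarHull.exists_hasRestrictionDeriv_holds hA hΦ
  set ρ₀ : ℝ := r' / 4 with hρ₀
  have hρ₀0 : 0 < ρ₀ := by positivity
  have hBρ : Disjoint (ball (0 : ℂ) (8 * ρ₀)) A := by
    rw [show 8 * ρ₀ = 2 * r' by rw [hρ₀]; ring]; exact hr'
  set ρ : ℝ := min r (4 * ρ₀) with hρ
  have hρ0 : 0 < ρ := lt_min hr (by positivity)
  refine ⟨d' * ρ / 4, by positivity, fun z hz hrz ↦ ?_⟩
  exact norm_apply_ge_of_le_norm hA hΦ hd' hρ₀0 hBρ hρ0 (min_le_right _ _) hz ((min_le_left _ _).trans hrz)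

/-- **`|Φ_A(z)| ≥ |z|/2` far out** (`Φ_A(z) − z → L_A` at `∞`, `tendsto_hullExt_sub_self`).
[cite: LawlerSchrammWerner2003Restriction, §2 pp. 7–8 (g_A(z) − z → 0, Φ_A = g_A − g_A(0))] -/
theorem exists_forall_norm_apply_ge_half (hA : IsStarHull A) (hΦ : IsRestrictionMap A Φ) :
    ∃ R : ℝ, 0 < R ∧ ∀ z ∈ upperHalfPlaneSet \ A, R ≤ ‖z‖ → ‖z‖ / 2 ≤ ‖Φ z‖ := by
  have h := tendsto_hullExt_sub_self hA.isBoundedHull hΦ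
  set L := hullShift Φ with hL
  have hev : ∀ᶠ z in cocompact ℂ, ‖hullExt Φ z - z - L‖ < 1 := by
    have := h.eventually (Metric.ball_mem_nhds L one_pos)
    filter_upwards [this] with z hz
    rwa [dist_eq_norm] at hz
  obtain ⟨K, hKc, hK⟩ := mem_cocompact.1 hev
  obtain ⟨R₀, hR₀⟩ := hKc.isBounded.subset_closedBall (0 : ℂ)
  refine ⟨max (max R₀ 0 + 1) (2 * (‖L‖ + 1)), by positivity, fun z hz hRz ↦ ?_⟩
  have hzK : z ∉ K := fun hzK ↦ by
    have := mem_closedBall_zero_iff.1 (hR₀ hzK)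
    have : max R₀ 0 + 1 ≤ ‖z‖ := (le_max_left _ _).trans hRz
    linarith [le_max_left R₀ 0]
  have h1 : ‖hullExt Φ z - z - L‖ < 1 := hK hzK
  rw [hullExt_of_mem_diff hz] at h1
  have h2 : 2 * (‖L‖ + 1) ≤ ‖z‖ := (le_max_right _ _).trans hRz
  have e1 : z = (Φ z - L) - (Φ z - z - L) := by ring
  have h3 : ‖z‖ ≤ ‖Φ z‖ + ‖L‖ + ‖Φ z - z - L‖ := by
    calc ‖z‖ = ‖(Φ z - L) - (Φ z - z - L)‖ := by rw [← e1]
      _ ≤ ‖Φ z - L‖ + ‖Φ z - z - L‖ := norm_sub_le _ _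
      _ ≤ ‖Φ z‖ + ‖L‖ + ‖Φ z - z - L‖ := by gcongr; exact norm_sub_le _ _
  linarith

end GlobalBounds


/-! ### The germ `F = −d/E_B + 1/z` at `0` and the limit `ψ_B → −SΦ_B(0)/6` -/

section LocalGerm

variable {B : Set ℂ} {Φ : ConformalEquiv (upperHalfPlaneSet \ B) upperHalfPlaneSet} {d ρ₀ : ℝ}

/-- **The holomorphic germ `F(z) = −d/E_B(z) + 1/z` at `0`**, written without division by `z`:
`F = (dslope q 0)/q` with `q = dslope E_B 0` (so `E_B(z) = z q(z)`, `q(0) = d`, and for `z ≠ 0`,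
`F(z) = (q(z) − d)/(z q(z)) = −d/E_B(z) + 1/z`). [folklore] -/
def bubbleGerm (Φ : ConformalEquiv (upperHalfPlaneSet \ B) upperHalfPlaneSet) : ℂ → ℂ := fun z ↦
  dslope (dslope (hullExt Φ) 0) 0 z / dslope (hullExt Φ) 0 z

/-- **The real number `F'(0) = E‴(0)/(6d) − (E″(0)/2)²/d² = SΦ_B(0)/6`** (for the canonical map,
`−starBubbleMass B`). [folklore] -/
def germSlope (Φ : ConformalEquiv (upperHalfPlaneSet \ B) upperHalfPlaneSet) (d : ℝ) : ℝ :=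
  (deriv (deriv (deriv (hullExt Φ))) 0).re / 6 / d - ((deriv (deriv (hullExt Φ)) 0).re / 2) ^ 2 / d ^ 2

variable (hB : IsStarHull B) (hΦ : IsRestrictionMap B Φ) (hd : HasRestrictionDeriv B Φ d)
  (hρ₀ : 0 < ρ₀) (hBρ : Disjoint (ball (0 : ℂ) (8 * ρ₀)) B)
include hB hΦ hd hρ₀ hBρ

omit hd in
/-- `E_B` is analytic at `0`. [folklore] -/
theorem analyticAt_hullExt_zero : AnalyticAt ℂ (hullExt Φ) 0 := by
  obtain ⟨-, hE, -⟩ := differentiableOn_hmap hB hΦ hρ₀ hBρ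
  exact hE.analyticAt (isOpen_ball.mem_nhds (mem_ball_self (by positivity)))

/-- **The power series bookkeeping**: `q(0) = d`, `(dslope q 0)(0) = q'(0) = E″(0)/2`,
`(dslope q 0)'(0) = E‴(0)/6`, both `q` and `dslope q 0` being analytic at `0`. [folklore] -/
theorem bubbleGerm_data :
    AnalyticAt ℂ (dslope (hullExt Φ) 0) 0 ∧ AnalyticAt ℂ (dslope (dslope (hullExt Φ) 0) 0) 0 ∧
      dslope (hullExt Φ) 0 0 = d ∧
      deriv (dslope (hullExt Φ) 0) 0 = deriv (deriv (hullExt Φ)) 0 / 2 ∧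
      dslope (dslope (hullExt Φ) 0) 0 0 = deriv (deriv (hullExt Φ)) 0 / 2 ∧
      deriv (dslope (dslope (hullExt Φ) 0) 0) 0 = deriv (deriv (deriv (hullExt Φ))) 0 / 6 := by
  set E := hullExt Φ with hEdef
  obtain ⟨p, r, hp⟩ := analyticAt_hullExt_zero hB hΦ hρ₀ hBρ
  have hpa : HasFPowerSeriesAt E p 0 := ⟨r, hp⟩
  have hq : HasFPowerSeriesAt (dslope E 0) p.fslope 0 := hpa.has_fpower_series_dslope_fslope
  have hg : HasFPowerSeriesAt (dslope (dslope E 0) 0) p.fslope.fslope 0 := hq.has_fpower_series_dslope_fslope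
  -- coefficients versus derivatives: `n! p_n = E⁽ⁿ⁾(0)`
  have hcoeff : ∀ n : ℕ, (n.factorial : ℂ) * p.coeff n = iteratedDeriv n E 0 := by
    intro n
    have h := hp.factorial_smul (1 : ℂ) n
    rw [iteratedDeriv_eq_iteratedFDeriv, ← h, nsmul_eq_mul]
    rfl
  have h2 : p.coeff 2 = deriv (deriv E) 0 / 2 := by
    have h := hcoeff 2
    rw [show iteratedDeriv 2 E = deriv (deriv E) by
      rw [iteratedDeriv_succ, iteratedDeriv_one]] at h
    norm_num [Nat.factorial] at h
    rw [← h]; ring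
  have h3 : p.coeff 3 = deriv (deriv (deriv E)) 0 / 6 := by
    have h := hcoeff 3
    rw [show iteratedDeriv 3 E = deriv (deriv (deriv E)) by
      rw [iteratedDeriv_succ, iteratedDeriv_succ, iteratedDeriv_one]] at h
    norm_num [Nat.factorial] at h
    rw [← h]; ring
  refine ⟨hq.analyticAt, hg.analyticAt, ?_, ?_, ?_, ?_⟩
  · rw [dslope_same, deriv_hullExt_zero hB hΦ hd]
  · rw [hq.deriv, ← h2]
    exact FormalMultilinearSeries.coeff_fslope (p := p) (n := 1)
  · rw [dslope_same, hq.deriv, ← h2]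
    exact FormalMultilinearSeries.coeff_fslope (p := p) (n := 1)
  · rw [hg.deriv, ← h3]
    exact (FormalMultilinearSeries.coeff_fslope (p := p.fslope) (n := 1)).trans
      (FormalMultilinearSeries.coeff_fslope (p := p) (n := 2))

omit hd in
/-- The jets `E″(0)`, `E‴(0)` are real. [folklore] -/
theorem deriv_two_three_hullExt_real :
    deriv (deriv (hullExt Φ)) 0 = ((deriv (deriv (hullExt Φ)) 0).re : ℂ) ∧
      deriv (deriv (deriv (hullExt Φ))) 0 = ((deriv (deriv (deriv (hullExt Φ))) 0).re : ℂ) := by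
  obtain ⟨-, h2, h3⟩ := im_iteratedDeriv_hullExt_ofReal hB hΦ hρ₀ hBρ (x := 0) (by rw [abs_zero]; positivity)
  rw [ofReal_zero] at h2 h3
  exact ⟨Complex.ext (by simp) (by simp [h2]), Complex.ext (by simp) (by simp [h3])⟩

/-- **`F` is analytic at `0` with `F'(0) = germSlope`** (strict differentiability is what the
two-sided difference quotient below needs). [folklore] -/
theorem hasStrictDerivAt_bubbleGerm : HasStrictDerivAt (bubbleGerm Φ) (germSlope Φ d : ℂ) 0 := by
  obtain ⟨hqa, hga, hq0, hq1, hg0, hg1⟩ := bubbleGerm_data hB hΦ hd hρ₀ hBρ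
  have hd0 : (0 : ℝ) < d := (restrictionDeriv_pos_le_one hB hΦ hd).1
  have hq0' : dslope (hullExt Φ) 0 0 ≠ 0 := by rw [hq0]; exact_mod_cast hd0.ne'
  have hF : AnalyticAt ℂ (bubbleGerm Φ) 0 := hga.div hqa hq0'
  have hstrict := hF.contDiffAt.hasStrictDerivAt (by simp : (⊤ : WithTop ℕ∞) ≠ 0)
  suffices heq : deriv (bubbleGerm Φ) 0 = (germSlope Φ d : ℂ) by rwa [heq] at hstrict
  have hderiv := deriv_div (c := dslope (dslope (hullExt Φ) 0) 0) (d := dslope (hullExt Φ) 0) (x := (0 : ℂ))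
    hga.differentiableAt hqa.differentiableAt hq0'
  change deriv ((dslope (dslope (hullExt Φ) 0) 0) / (dslope (hullExt Φ) 0)) 0 = _
  rw [hderiv, hg1, hq0, hg0, hq1]
  obtain ⟨e2, e3⟩ := deriv_two_three_hullExt_real hB hΦ hρ₀ hBρ
  rw [e2, e3, germSlope]
  have hd' : (d : ℂ) ≠ 0 := by exact_mod_cast hd0.ne'
  push_cast
  field_simp

/-- **`F(z) = −d/E_B(z) + 1/z` for `0 ≠ z ∈ B(0, 4ρ₀)`.** [folklore] -/
theorem bubbleGerm_of_ne_zero {z : ℂ} (hz : z ∈ ball (0 : ℂ) (4 * ρ₀)) (hz0 : z ≠ 0) :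
    bubbleGerm Φ z = -(d : ℂ) / hullExt Φ z + z⁻¹ := by
  have hE0 : hullExt Φ 0 = 0 := hullExt_zero hB hΦ
  have hEz : hullExt Φ z ≠ 0 := hullExt_ne_zero hB hΦ hd hρ₀ hBρ hz hz0
  have hq : dslope (hullExt Φ) 0 z = hullExt Φ z / z := by
    rw [dslope_of_ne _ hz0, slope_def_field, hE0, sub_zero, sub_zero]
  have hq0 : dslope (hullExt Φ) 0 0 = d := by rw [dslope_same, deriv_hullExt_zero hB hΦ hd]
  have hg : dslope (dslope (hullExt Φ) 0) 0 z = (hullExt Φ z / z - d) / z := by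
    rw [dslope_of_ne _ hz0, slope_def_field, hq, hq0, sub_zero]
  rw [bubbleGerm, hg, hq]
  field_simp
  ring

/-- **`F(z̄) = conj F(z)` on `B(0, 4ρ₀)`** (`E_B(z̄) = conj E_B(z)`; `F(0) = E″(0)/(2d)` is real). [folklore] -/
theorem bubbleGerm_conj {z : ℂ} (hz : z ∈ ball (0 : ℂ) (4 * ρ₀)) :
    bubbleGerm Φ (conj z) = conj (bubbleGerm Φ z) := by
  obtain ⟨hsub, -, -⟩ := differentiableOn_hmap hB hΦ hρ₀ hBρ
  rcases eq_or_ne z 0 with rfl | hz0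
  · obtain ⟨-, -, hq0, hq1, hg0, -⟩ := bubbleGerm_data hB hΦ hd hρ₀ hBρ
    obtain ⟨e2, -⟩ := deriv_two_three_hullExt_real hB hΦ hρ₀ hBρ
    rw [map_zero, bubbleGerm, hg0, hq0, e2, ← ofReal_ofNat, ← ofReal_div, ← ofReal_div, conj_ofReal]
  · have hzc : conj z ∈ ball (0 : ℂ) (4 * ρ₀) := by
      rwa [mem_ball_zero_iff, norm_conj, ← mem_ball_zero_iff]
    have hzc0 : conj z ≠ 0 := by rwa [Ne, map_eq_zero]
    rw [bubbleGerm_of_ne_zero hB hΦ hd hρ₀ hBρ hz hz0, bubbleGerm_of_ne_zero hB hΦ hd hρ₀ hBρ hzc hzc0,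
      hullExt_conj hB.isBoundedHull hΦ (hsub hz)]
    simp [map_div₀]

/-- **`Im F(z)/Im z → F'(0) = germSlope` as `z → 0` inside `ℍ ∖ B`** (strict differentiability at
`0` and `Im F(z)/Im z = (F(z) − F(z̄))/(z − z̄)`; verbatim the argument of
`IsRestrictionMap.tendsto_im_div_im_nhdsWithin_zero`). [folklore] -/
theorem tendsto_im_bubbleGerm_div_im :
    Tendsto (fun z ↦ (bubbleGerm Φ z).im / z.im) (𝓝[upperHalfPlaneSet \ B] 0) (𝓝 (germSlope Φ d)) := by
  set F := bubbleGerm Φ with hFdef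
  set κ := germSlope Φ d with hκ
  have hstrict : HasStrictDerivAt F (κ : ℂ) 0 := hasStrictDerivAt_bubbleGerm hB hΦ hd hρ₀ hBρ
  have ho := hasDerivAtFilter_iff_isLittleO.1 hstrict
  have hk : Tendsto (fun z : ℂ ↦ (z, conj z)) (𝓝[upperHalfPlaneSet \ B] 0) (𝓝 (0, 0)) := by
    have hc : Continuous fun z : ℂ ↦ (z, conj z) := continuous_id.prodMk continuous_conj
    have h := hc.tendsto 0
    simp only [map_zero] at h
    exact h.mono_left nhdsWithin_le_nhds
  have ho' := ho.comp_tendsto hk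
  have hball : ∀ᶠ z in 𝓝[upperHalfPlaneSet \ B] (0 : ℂ), z ∈ ball (0 : ℂ) (4 * ρ₀) :=
    mem_nhdsWithin_of_mem_nhds (ball_mem_nhds _ (by positivity))
  rw [Metric.tendsto_nhds]
  intro ε hε
  filter_upwards [ho'.def (half_pos hε), self_mem_nhdsWithin, hball] with z hz hzO hzb
  have hzim : 0 < z.im := hzO.1
  have hconj : F (conj z) = conj (F z) := bubbleGerm_conj hB hΦ hd hρ₀ hBρ hzb
  have hf : F z - F (conj z) - (z - conj z) • (κ : ℂ) = ((2 * ((F z).im - κ * z.im) : ℝ) : ℂ) * I := by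
    rw [hconj, Complex.sub_conj, Complex.sub_conj, smul_eq_mul]
    push_cast
    ring
  have hnf : ‖F z - F (conj z) - (z - conj z) • (κ : ℂ)‖ = 2 * |(F z).im - κ * z.im| := by
    rw [hf, norm_mul, norm_I, mul_one, norm_real, Real.norm_eq_abs, abs_mul, abs_two]
  have hng : ‖z - conj z‖ = 2 * z.im := by
    rw [Complex.sub_conj, norm_mul, norm_I, mul_one, norm_real, Real.norm_eq_abs, abs_mul, abs_two,
      abs_of_pos hzim]
  have hz' : 2 * |(F z).im - κ * z.im| ≤ ε / 2 * (2 * z.im) := by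
    have := hz
    simp only [Function.comp_apply] at this
    rwa [hnf, hng] at this
  rw [Real.dist_eq, show (F z).im / z.im - κ = ((F z).im - κ * z.im) / z.im by field_simp,
    abs_div, abs_of_pos hzim, div_lt_iff₀ hzim]
  nlinarith

/-- **`ψ_B = −Im F/Im z` near `0`**: for `p ∈ D_B` with `z = x + i|w| ∈ B(0, 4ρ₀)`,
`ψ_B(p) = −Im F(z)/Im z` (`E_B = Φ_B` on `ℍ ∖ B`, `Im(1/z)/Im z = −1/|z|²`). [folklore] -/
theorem bubbleHarmonic_eq_neg_im_bubbleGerm (hd0 : 0 < d) {p : Fin 4 → ℝ} (hp : p ∈ exDom B)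
    (hpb : exPt p ∈ ball (0 : ℂ) (4 * ρ₀)) :
    bubbleHarmonic Φ d hd0 p = -((bubbleGerm Φ (exPt p)).im / (exPt p).im) := by
  have hz : exPt p ∈ upperHalfPlaneSet \ B := exPt_mem_of_mem hp
  have hz0 : exPt p ≠ 0 := by
    intro h
    have : (0 : ℝ) < (exPt p).im := hz.1
    rw [h] at this; simp at this
  rw [bubbleGerm_of_ne_zero hB hΦ hd hρ₀ hBρ hpb hz0, hullExt_of_mem_diff hz, bubbleHarmonic,
    excursionRatio_negInvEmpty hp.1, excursionRatio, negDivMap_apply, Complex.add_im, add_div,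
    Complex.inv_im, exPt_im]
  have hr : exRad p ≠ 0 := hp.1
  field_simp
  ring

/-- **`ψ_B(p) → −germSlope` as `p → 0` inside `D_B`.** [folklore] -/
theorem tendsto_bubbleHarmonic_nhdsWithin_zero (hd0 : 0 < d) :
    Tendsto (bubbleHarmonic Φ d hd0) (𝓝[exDom B] 0) (𝓝 (-germSlope Φ d)) := by
  have h0 : exPt 0 = 0 := Complex.ext (by simp) (by simp)
  have hk : Tendsto exPt (𝓝[exDom B] 0) (𝓝[upperHalfPlaneSet \ B] 0) := by
    have h := (continuous_exPt.continuousWithinAt (s := exDom B) (x := 0)).tendsto_nhdsWithin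
      (fun p hp ↦ exPt_mem_of_mem hp)
    rwa [h0] at h
  have h1 := ((tendsto_im_bubbleGerm_div_im hB hΦ hd hρ₀ hBρ).comp hk).neg
  have hball : ∀ᶠ p in 𝓝[exDom B] (0 : Fin 4 → ℝ), exPt p ∈ ball (0 : ℂ) (4 * ρ₀) := by
    have : Tendsto exPt (𝓝[exDom B] 0) (𝓝 0) := by
      have := (continuous_exPt.tendsto (0 : Fin 4 → ℝ)).mono_left (nhdsWithin_le_nhds (s := exDom B))
      rwa [h0] at this
    exact this.eventually (ball_mem_nhds _ (by positivity))
  refine h1.congr' ?_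
  filter_upwards [self_mem_nhdsWithin, hball] with p hp hpb
  rw [Function.comp_apply, bubbleHarmonic_eq_neg_im_bubbleGerm hB hΦ hd hρ₀ hBρ hd0 hp hpb]

end LocalGerm

/-! ### The canonical map: `ψ_B(p) → −SΦ_B(0)/6` -/

/-- For the canonical map `Φ_B`, `germSlope = SΦ_B(0)/6 = −starBubbleMass B`. [folklore] -/
theorem germSlope_starRMap {B : Set ℂ} (h : IsStarHull B) :
    germSlope (starRMap B h) (starDeriv B) = -starBubbleMass B := by
  rw [germSlope, starBubbleMass_eq, starJet2, starJet3, starMap_eq h]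
  ring

/-- **`ψ_B → −SΦ_B(0)/6` at `0`** for the canonical data of a `*`-hull:
`ψ_B(p) → starBubbleMass B` as `p → 0` inside `D_B`. [cite: LawlerSchrammWerner2003Restriction, §7.1 eq. (7.2) with §5 (5.1)] -/
theorem tendsto_bubbleHarmonic_starRMap {B : Set ℂ} (h : IsStarHull B) :
    Tendsto (bubbleHarmonic (starRMap B h) (starDeriv B) (starDeriv_spec h).1) (𝓝[exDom B] 0)
      (𝓝 (starBubbleMass B)) := by
  obtain ⟨r, hr0, hr⟩ := h.exists_disjoint_ball
  have hρ₀ : 0 < r / 4 := by positivity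
  have hBρ : Disjoint (ball (0 : ℂ) (8 * (r / 4))) B := by
    rwa [show 8 * (r / 4) = 2 * r by ring]
  have := tendsto_bubbleHarmonic_nhdsWithin_zero h (isRestrictionMap_starRMap h) (starDeriv_spec h).2.2
    hρ₀ hBρ (starDeriv_spec h).1
  rwa [germSlope_starRMap h, neg_neg] at this


/-! ### Boundary behaviour of `ψ_A`: at the lifted hull, at `∞`; global boundedness -/

section Boundary

variable {Φ : ConformalEquiv (upperHalfPlaneSet \ A) upperHalfPlaneSet} {d : ℝ} {hd : 0 < d}

/-- `|xᵢ| ≤ ‖x + i|w|‖`: the sup norm of `p ∈ ℝ⁴` is at most the modulus of its excursion point.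
[folklore] -/
theorem norm_le_norm_exPt (p : Fin 4 → ℝ) : ‖p‖ ≤ ‖exPt p‖ := by
  have him : exRad p ≤ ‖exPt p‖ := by
    have h := Complex.abs_im_le_norm (exPt p)
    rwa [exPt_im, abs_of_nonneg (exRad_nonneg p)] at h
  have hre : |p 0| ≤ ‖exPt p‖ := by
    have h := Complex.abs_re_le_norm (exPt p)
    rwa [exPt_re] at h
  have hsq : ∀ x : ℝ, x ^ 2 ≤ p 1 ^ 2 + p 2 ^ 2 + p 3 ^ 2 → |x| ≤ exRad p := fun x hx ↦ by
    rw [← Real.sqrt_sq_eq_abs, exRad]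
    exact Real.sqrt_le_sqrt hx
  have h1 : |p 1| ≤ exRad p := hsq _ (by nlinarith [sq_nonneg (p 2), sq_nonneg (p 3)])
  have h2 : |p 2| ≤ exRad p := hsq _ (by nlinarith [sq_nonneg (p 1), sq_nonneg (p 3)])
  have h3 : |p 3| ≤ exRad p := hsq _ (by nlinarith [sq_nonneg (p 1), sq_nonneg (p 2)])
  refine (pi_norm_le_iff_of_nonneg (norm_nonneg _)).2 fun i ↦ ?_
  rw [Real.norm_eq_abs]
  obtain ⟨i, hi⟩ := i
  interval_cases i
  · exact hre
  · exact h1.trans him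
  · exact h2.trans him
  · exact h3.trans him

/-- **`u_A(p) → 0` as `p → q ∈ D`-boundary point over `A ∩ ℍ`** (`Im Φ_A → 0` there,
`tendsto_excursionRatio_of_mem`, and `|Φ_A|` stays bounded below away from `0`).
[cite: LawlerSchrammWerner2003Restriction, proof of Prop. 4.1 (p. 16)] -/
theorem tendsto_excursionRatio_negDivMap_of_mem (hA : IsStarHull A) (hΦ : IsRestrictionMap A Φ)
    {q : Fin 4 → ℝ} (hq : exRad q ≠ 0) (hqA : exPt q ∈ A) :
    Tendsto (excursionRatio (negDivMap Φ d hd)) (𝓝[exDom A] q) (𝓝 0) := by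
  have hq0 : 0 < ‖exPt q‖ := by
    have : 0 < (exPt q).im := by rw [exPt_im]; exact exRad_pos hq
    exact norm_pos_iff.2 fun h ↦ by rw [h] at this; simp at this
  obtain ⟨c, hc, hcΦ⟩ := exists_forall_norm_apply_ge hA hΦ (half_pos hq0)
  -- near `q`, `‖exPt p‖ ≥ ‖exPt q‖/2`
  have hnear : ∀ᶠ p in 𝓝[exDom A] q, ‖exPt q‖ / 2 ≤ ‖exPt p‖ := by
    have h1 : ∀ᶠ p in 𝓝 q, ‖exPt q‖ / 2 < ‖exPt p‖ :=
      (continuous_exPt.norm.tendsto q).eventually (lt_mem_nhds (by linarith))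
    exact mem_nhdsWithin_of_mem_nhds (h1.mono fun p hp ↦ hp.le)
  have hbound : ∀ᶠ p in 𝓝[exDom A] q, |excursionRatio (negDivMap Φ d hd) p| ≤
      d / c ^ 2 * excursionRatio Φ p := by
    filter_upwards [hnear, self_mem_nhdsWithin] with p hp hpD
    have hpos := excursionRatio_pos (Φ := negDivMap Φ d hd) hpD
    rw [abs_of_pos hpos, excursionRatio_negDivMap]
    have hΦp : c ≤ ‖Φ (exPt p)‖ := hcΦ _ (exPt_mem_of_mem hpD) hp
    have hns : c ^ 2 ≤ Complex.normSq (Φ (exPt p)) := by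
      rw [Complex.normSq_eq_norm_sq]; exact pow_le_pow_left₀ hc.le hΦp 2
    have hr : 0 ≤ excursionRatio Φ p := (excursionRatio_pos hpD).le
    rw [div_mul_eq_mul_div, mul_comm]
    exact div_le_div_of_nonneg_left (by positivity) (by positivity) hns
  have hlim : Tendsto (fun p ↦ d / c ^ 2 * excursionRatio Φ p) (𝓝[exDom A] q) (𝓝 0) := by
    have := (tendsto_excursionRatio_of_mem hA hΦ hq hqA).const_mul (d / c ^ 2)
    rwa [mul_zero] at this
  exact squeeze_zero_norm' hbound hlim

/-- **`ψ_A(p) → N(q) = 1/|z_q|²` as `p → q` inside `D_A`, for `q` off the axis with excursion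
point in `A`** (the boundary values of `ψ_A` on the lifted hull). [folklore] -/
theorem tendsto_bubbleHarmonic_of_mem (hA : IsStarHull A) (hΦ : IsRestrictionMap A Φ)
    {q : Fin 4 → ℝ} (hq : exRad q ≠ 0) (hqA : exPt q ∈ A) :
    Tendsto (bubbleHarmonic Φ d hd) (𝓝[exDom A] q) (𝓝 ((Complex.normSq (exPt q))⁻¹)) := by
  have hq' : q ∈ exDom (∅ : Set ℂ) := ⟨hq, fun h ↦ h⟩
  have hN : Tendsto (excursionRatio negInvEmpty) (𝓝[exDom A] q) (𝓝 ((Complex.normSq (exPt q))⁻¹)) := by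
    have hc : ContinuousAt (excursionRatio negInvEmpty) q :=
      (continuousOn_excursionRatio isClosed_empty).continuousAt ((isOpen_exDom isClosed_empty).mem_nhds hq')
    rw [← excursionRatio_negInvEmpty hq]
    exact hc.tendsto.mono_left nhdsWithin_le_nhds
  have h := hN.sub (tendsto_excursionRatio_negDivMap_of_mem (hd := hd) hA hΦ hq hqA)
  rw [sub_zero] at h
  exact h

/-- **`ψ_A` is small far out**: `|ψ_A(p)| ≤ (1 + 4d)/‖z‖²` for `z = x + i|w|` large.
[folklore] -/
theorem exists_forall_abs_bubbleHarmonic_le_div (hA : IsStarHull A) (hΦ : IsRestrictionMap A Φ) :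
    ∃ R : ℝ, 0 < R ∧ ∀ p ∈ exDom A, R ≤ ‖exPt p‖ →
      |bubbleHarmonic Φ d hd p| ≤ (1 + 4 * d) / ‖exPt p‖ ^ 2 := by
  obtain ⟨R, hR, hfar⟩ := exists_forall_norm_apply_ge_half hA hΦ
  refine ⟨R, hR, fun p hp hRp ↦ ?_⟩
  have hz : 0 < ‖exPt p‖ := hR.trans_le hRp
  have hup : bubbleHarmonic Φ d hd p ≤ 1 / ‖exPt p‖ ^ 2 := bubbleHarmonic_le hp hz le_rfl
  have hΦ' : ‖exPt p‖ / 2 ≤ ‖Φ (exPt p)‖ := hfar _ (exPt_mem_of_mem hp) hRp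
  have hlow : -(d / (‖exPt p‖ / 2) ^ 2) ≤ bubbleHarmonic Φ d hd p :=
    neg_le_bubbleHarmonic hA hΦ hp (by positivity) hΦ'
  rw [abs_le]
  constructor
  · have : d / (‖exPt p‖ / 2) ^ 2 = 4 * d / ‖exPt p‖ ^ 2 := by
      field_simp; ring
    rw [this] at hlow
    have h1 : 4 * d / ‖exPt p‖ ^ 2 ≤ (1 + 4 * d) / ‖exPt p‖ ^ 2 :=
      div_le_div_of_nonneg_right (by linarith) (by positivity)
    linarith
  · have h1 : 1 / ‖exPt p‖ ^ 2 ≤ (1 + 4 * d) / ‖exPt p‖ ^ 2 :=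
      div_le_div_of_nonneg_right (by linarith [hd.le]) (by positivity)
    linarith

/-- **`ψ_A` is bounded on `D_A ∖ B(0, r)`** for every `r > 0`. [folklore] -/
theorem exists_forall_abs_bubbleHarmonic_le_of_le (hA : IsStarHull A) (hΦ : IsRestrictionMap A Φ)
    {r : ℝ} (hr : 0 < r) :
    ∃ C : ℝ, ∀ p ∈ exDom A, r ≤ ‖exPt p‖ → |bubbleHarmonic Φ d hd p| ≤ C := by
  obtain ⟨c, hc, hcΦ⟩ := exists_forall_norm_apply_ge hA hΦ hr
  refine ⟨max (1 / r ^ 2) (d / c ^ 2), fun p hp hrp ↦ abs_le.2 ⟨?_, ?_⟩⟩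
  · have := neg_le_bubbleHarmonic (hd := hd) hA hΦ hp hc (hcΦ _ (exPt_mem_of_mem hp) hrp)
    have h2 : d / c ^ 2 ≤ max (1 / r ^ 2) (d / c ^ 2) := le_max_right _ _
    linarith
  · exact (bubbleHarmonic_le hp hr hrp).trans (le_max_left _ _)

end Boundary

/-- **`ψ_B` is bounded on all of `D_B`** for the canonical data of a `*`-hull: near `0` it tends
to `−SΦ_B(0)/6`, away from `0` it is squeezed between `−d/c²` and `1/r²`. [folklore] -/
theorem exists_forall_abs_bubbleHarmonic_le {B : Set ℂ} (h : IsStarHull B) :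
    ∃ C : ℝ, ∀ p ∈ exDom B, |bubbleHarmonic (starRMap B h) (starDeriv B) (starDeriv_spec h).1 p| ≤ C := by
  set ψ := bubbleHarmonic (starRMap B h) (starDeriv B) (starDeriv_spec h).1 with hψ
  set m := starBubbleMass B
  have hlim := tendsto_bubbleHarmonic_starRMap h
  -- near `0`
  have hev : ∀ᶠ p in 𝓝[exDom B] (0 : Fin 4 → ℝ), dist (ψ p) m < 1 := Metric.tendsto_nhds.1 hlim 1 one_pos
  obtain ⟨U, hU, hU'⟩ := eventually_nhdsWithin_iff.1 hev |> Metric.eventually_nhds_iff.1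
  -- hU : 0 < U (radius), hU' : ∀ y, dist y 0 < U → y ∈ exDom B → dist (ψ y) m < 1
  obtain ⟨C₁, hC₁⟩ := exists_forall_abs_bubbleHarmonic_le_of_le (hd := (starDeriv_spec h).1) h
    (isRestrictionMap_starRMap h) hU
  refine ⟨max (|m| + 1) C₁, fun p hp ↦ ?_⟩
  by_cases hpU : ‖exPt p‖ < U
  · have hpn : dist p 0 < U := by
      rw [dist_zero_right]; exact (norm_le_norm_exPt p).trans_lt hpU
    have := hU' hpn hp
    rw [Real.dist_eq] at this
    have : |ψ p| ≤ |m| + 1 := by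
      have := abs_sub_abs_le_abs_sub (ψ p) m
      linarith
    exact this.trans (le_max_left _ _)
  · exact (hC₁ p hp (not_lt.1 hpU)).trans (le_max_right _ _)

end Literature.Probability.RandomPlanarGeometry
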